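import Summits.QuantumFields.YangMills.Theorems.FluctuationComparisonRegPrIntLOrganTangentTaylorCutHV23
import Summits.QuantumFields.YangMills.Theorems.FluctuationComparisonRegPrIntLOrganTangentJensenHOfJvarHV23
import Summits.QuantumFields.YangMills.Theorems.FluctuationComparisonRegPrIntLRunpairOrganFibreLawJSqEDefs
import Summits.QuantumFields.YangMills.Theorems.FluctuationComparisonRegPrIntLOrganTangentTangentHOfSpreadFibreLawSqE
import Summits.QuantumFields.YangMills.Theorems.FluctuationComparisonRegPrIntLOrganTangentJvarHOfSpreadFibreLawJSqE
import HarnessLib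

/-!
# ᴱ-EDITION (E) of ✓`…OrganTangentOneStepTransportUHOfSpreadFibreLawHJsq` — RULING №60∕№105 «BACKGROUND WINDOWS»: block ⑤ of the inlined frame texts re-lettered (px8 g25 Φ_h),
# measurability helper re-pointed (SPEC-2); every other byte of statements∕proofs VERBATIM; width seat `ym-ust-20520-w5` g26 pen (LEAD w3 g28 №44), generator `gen_sqE.py`.
# Crux `FluctuationComparisonRegPrIntL` (stmt-QuantumFields-20520, rung R3), PATH-B organ, sq-programme step (sq2): «THE sq-APEX» —
# **O1ᵘ-H v2.2 ⟸ `SpreadFibreLawHJsq`** (the NEAR-PAIR edition) by composing BRICK 1 v2.2 with the near-pair LIN knit and E2E v2.2 ∘ the near-pair Jensen knit — DEFINITION-FREE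

Cell `ym3-torus` (YM ladder rung R3 = continuum `SU(2)` Yang–Mills on the three-torus — a RUNG: NOT d = 4, NOT infinite volume, NOT a mass gap, NOT Clay).
Width seat `ym-ust-20520-w4` (gen 24), apex lineage; LEAD-20520 w3 g26 RULING №38 (3) ∕ №40 (A): «apex-sq FIRST — it is the kernel certificate of "near pairs only"»;
`--kind proof --supports stmt-QuantumFields-20520 --as helper`, count-neutral, no registry ∕ binder ∕ `Lines/` edit, default heartbeats, `autoImplicit false`.

WHAT THIS IS.  ONE composition theorem.  ✓p814811 proved O1ᵘ-H v2.2 (the text of `Lines/runpair_organ.lean`'s `stub_oneStepTransportUH`) from the frozen ALL-PAIRS row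
`SpreadFibreLawHJ`.  w4 g24's TN-HGLOB-FRAME (HOME `ym-ust-20520-w4/g24/TN-HGLOB-FRAME-w4g24.md` 514ad89e; instr-1 g14 FL-34; LEAD №38; desk №415∕№416) located the far-pair
quantification of that row ((JT-h)'s free law point, (L1ʲ-h)∕(JV3-h′)'s unrelated edges, (JV0-h)∕(JV1-h)∕(JV2-h)'s free law point) as dischargeable from print only through
an unprinted gauge lemma, while every CONSUMER instantiates near pairs only (INSTANCE TABLE 96d7f6a7).  The near-pair edition `SpreadFibreLawHJsq` (✓`…RunpairOrganFibreLawJSqDefs`,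
script-generated binder restriction of ✓p814004; `SpreadFibreLawHJ → SpreadFibreLawHJsq` ✓`…SpreadFibreLawHJsqOfHJ`) feeds the SAME consumer proofs: ✓`…TangentHOfSpreadFibreLawSq`
(LIN knit, near-pair edition) and ✓`…JvarHOfSpreadFibreLawJSq` (Jensen knit, near-pair edition), whose conclusions LINᵘ-H″ ∕ JVARᵘ-H″ are byte-identical to ✓p812884's ∕
✓p814161's.  Hence, with BRICK 1 v2.2 ✓p812444 and E2E v2.2 ✓p812220 unchanged:

  ★★★`oneStepTransportUH_of_spreadFibreLawHJsq (hF : SpreadFibreLawHJsq) : ⟨O1ᵘ-H v2.2, VERBATIM = ✓p814811's conclusion, ws16 6a04f4fc⟩ :=`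
  `  OrganTangentTaylorCutHV23.oneStepTransportUH_of_tangentH_jensenH`
  `    (OrganTangentTangentHOfSpreadFibreLawSqE.tangentH_of_spreadFibreLawHJsq hF)`
  `    (OrganTangentJensenHOfJvarHV23.jensenH_of_jvarH (OrganTangentJvarHOfSpreadFibreLawJSqE.jvarH_of_spreadFibreLawHJsq hF))`

So the organ stub's debt is, BY KERNEL AND BY NAME, {`SpreadFibreLawHJsq`} — the NEAR-PAIR row, whose clauses are of print shape ([Balaban1985Variational] Thm 1 (9)–(10), Prop 9
in a common frame) — and ✓p814811's all-pairs row was never needed in its far-pair strength.  This is the kernel certificate LEAD №38 asked for; it discharges nothing.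

HONEST FRAMING: a three-name term; nothing of Bałaban's analysis is asserted or proved; `SpreadFibreLawHJsq`, LIN″, JEN″, JVAR″, O1ᵘ-H v2.2 (now a theorem MODULO
`SpreadFibreLawHJsq`), S1aᴴ, S3ᴴ, 26243, S2α′, S2β and the five registered stubs are OPEN ∕ hypotheses; crux 20520 `FluctuationComparisonRegPrIntL` ∕ `YM3TorusSU2` are NOT
proved; no summit ∕ sub-problem statement is proved; rung R3 = SU(2) YM₃ on T³ at fixed lattice data — NOT d = 4, NOT infinite volume, NOT a mass gap, NOT Clay; the
Yang–Mills mass gap is NOT proved.  [folklore] composition.  Credit: LEAD w3 g25∕g26 (bricks, knits), px5 g19∕g20 (Jensen side), px13 g22 (BRICK 1 v2.2), px19 g20, w5 g22–g24,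
ideator g27–g29, instr-1 g14, desk g44.
-/

set_option autoImplicit false

noncomputable section

namespace Summit.QuantumFields.YangMills.Theorems.OrganTangentOneStepTransportUHOfSpreadFibreLawHJsqE

-- ᴱ: px8 g25's Φ_h names lit `iterBlockOf` (the blocks' feet) unqualified
open Literature.MathematicalPhysics.QuantumFieldTheory.Balaban1983to89.B5Eq118OneStroke (iterBlockOf)
open MeasureTheory Filter Topology Function
open scoped ENNReal
open Literature.MathematicalPhysics.QuantumFieldTheory.Balaban1983to89 T3ContinuumYM3Torus T3NestedUnitLaws
  T3UnitLawDensityEML T4Continuum BalabanUVClass T3UnitScaleTilt T3LevelShift T3TiltDescent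
open T4CubeChartExp (expPt)
open Summit.QuantumFields.YangMills.Theorems.FluctuationComparisonRegPrIntLRunpairOrganFibreLawJSqE (SpreadFibreLawHJsq)

/-- ★★★ **THE sq-APEX**: O1ᵘ-H v2.2 (text VERBATIM from ✓p814811's conclusion) from the NEAR-PAIR hypothesis row `SpreadFibreLawHJsq`, by BRICK 1 v2.2 ∘ (near-pair LIN
knit, E2E v2.2 ∘ near-pair Jensen knit).  The kernel certificate that the organ-tangent cone never used a far pair; nothing of Bałaban's is proved.
[cite: Balaban1985Variational, Thm 1 p.279 and Prop 9 p.309; Balaban1987RG1, Thm 1 (0.22)-(0.30) pp.256-258 and Thm 3 p.264; Balaban1985UV3, (41)-(47) pp.266-267; Balaban1985Averaging, (10)-(13) p.19] -/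
theorem oneStepTransportUH_of_spreadFibreLawHJsq (hF : SpreadFibreLawHJsq) :
    ∃ pW : ℝ, ∃ γ₁ : ℝ, 0 < γ₁ ∧ ∀ (F : T3Family) (γ : ℝ), 0 < γ → γ ≤ γ₁ → ∀ (b₀ p₀ : ℝ) (j₀ : ℕ) (prm : ℕ → ClassParams) (η : ℕ → ℝ) (rA : ℝ) (Bρ : ℕ → ℝ), 0 < b₀ → 0 < p₀ → pW ≤ p₀ → AdmissibleClassParams F γ b₀ p₀ prm → (∀ j, 0 ≤ η j) → Summable η → Summable (fun i => ∑' k, η (k + i)) → Tendsto (fun j => (∑' k, η (k + j)) * ((1 + 2 * ((F.L : ℝ) ^ j / γ) * (Fintype.card (Plaq (F.P j) 0) : ℝ)) * (Fintype.card (PBond (F.P j) 0) : ℝ) ^ 2)) atTop (𝓝 0) → 0 < rA → ∃ κ₀ : ℝ, 0 < κ₀ ∧ ∀ (κ : ℝ), 0 < κ → κ ≤ κ₀ → ∃ (θ r Ctr C w₀ : ℝ) (εd δ : ℕ → ℝ) (j₁ : ℕ), 0 < θ ∧ 0 < r ∧ 1 ≤ Ctr ∧ 0 ≤ C ∧ 0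 < w₀ ∧ (∀ j, 0 ≤ εd j ∧ 0 ≤ δ j) ∧ Summable εd ∧ Summable δ ∧ Summable (fun i => ∑' k, δ (k + i)) ∧ Tendsto (fun j => (∑' k, δ (k + j)) * ((1 + 2 * ((F.L : ℝ) ^ j / γ) * (Fintype.card (Plaq (F.P j) 0) : ℝ)) * (Fintype.card (PBond (F.P j) 0) : ℝ) ^ 2)) atTop (𝓝 0) ∧ j₀ ≤ j₁ ∧ ∀ (ν : ℕ → (j : ℕ) → MeasureTheory.Measure (GaugeField (F.P j) 0 ↥(Matrix.specialUnitaryGroup (Fin 2) ℂ))), (∀ K, ν K K = T4GenFunBounds.gibbsMeasure (F.P K) ((F.scheme ℰp γ).β K)) → (∀ K j, j < K → ν K j = Measure.map (descend F ℰp j) (ν K (j + 1))) → ∀ (K K' : ℕ), K ≤ K' → ∀ (Ts T : ℕ), Ts < T → T ≤ K → ∀ (μ μ' : ((j : ℕ) → MeasureTheory.Measure (GaugeField (F.P j) 0 ↥(Matrix.specialUnitaryGroup (Fin 2) ℂ)))) (ρ ρ' : ((j : ℕ) → GaugeField (F.P j) 0 ↥(Matrix.specialUnitaryGroup (Fin 2)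 ℂ) → ℝ)), (∀ j : ℕ, Ts ≤ j → j ≤ T → μ j = ν K j ∧ μ' j = ν K' j) → (∀ j : ℕ, j < Ts → μ j = Measure.map (descend F ℰp j) ((μ (j + 1)).withDensity (fun U => ENNReal.ofReal ((∏ p : Plaq _ _, max 0 (min 1 ((24 / 25 * (θBal F.L γ b₀ p₀ (j + 1)) - dist1 (GaugeField.plaqHol U p)) / ((24 / 25 - 1 / 2) * (θBal F.L γ b₀ p₀ (j + 1))))))))) ∧ μ' j = Measure.map (descend F ℰp j) ((μ' (j + 1)).withDensity (fun U => ENNReal.ofReal ((∏ p : Plaq _ _, max 0 (min 1 ((24 / 25 * (θBal F.L γ b₀ p₀ (j + 1)) - dist1 (GaugeField.plaqHol U p)) / ((24 / 25 - 1 / 2) * (θBal F.L γ b₀ p₀ (j + 1)))))))))) → (∀ j : ℕ, Ts ≤ j → j < T → μ j = Measure.map (descend F ℰp j) (μ (j + 1)) ∧ μ' j = Measure.map (descend F ℰp j) (μ' (j + 1))) → (∀ j : ℕ, j ≤ T → IsFiniteMeasure (μ j) ∧ IsFiniteMeasure (μ' j)) → (∀ j : ℕ, j₀ ≤ j → j ≤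 T → ((∀ U, PlaqSmall (θBal F.L γ b₀ p₀ j) U → 0 < ρ j U ∧ 0 < ρ' j U) ∧ μ j = (fieldMeasure _ _ _).withDensity (fun U => ENNReal.ofReal (ρ j U)) ∧ μ' j = (fieldMeasure _ _ _).withDensity (fun U => ENNReal.ofReal (ρ' j U)) ∧ (∃ (K : ℕ) (hjK : j ≤ K),
        ∃ κ : ℝ, ∃ (bg : GaugeField (F.P K) (K - j) (Matrix.specialUnitaryGroup (Fin 2) ℂ) → GaugeField (F.P K) 0 (Matrix.specialUnitaryGroup (Fin 2) ℂ))
          (nDom : ℕ) (supp : Fin nDom → Set (PBond (F.P K) 0)) (foot : Fin nDom → Finset (Site (F.P K) (K - j)))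
          (len : Fin nDom → ℝ) (wt : Fin nDom → ℝ) (act : Fin nDom → GaugeField (F.P K) 0 (Matrix.specialUnitaryGroup (Fin 2) ℂ) → ℝ)
          (cst : ℝ) (lf : GaugeField (F.P K) (K - j) (Matrix.specialUnitaryGroup (Fin 2) ℂ) → ℝ),
          (∀ V, 0 ≤ readAtLevel F hjK (fun U => Real.exp κ * ρ j U) V) ∧
          Measurable (readAtLevel F hjK (fun U => Real.exp κ * ρ j U)) ∧
          GaugeField.GaugeInvariant (readAtLevel F hjK (fun U => Real.exp κ * ρ j U)) ∧
          (∀ V, PlaqSmall (prm j).δ V →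
            IsBackground (fun i => BlockAveraging.blockAvg (P := F.P K) (j := i) ℰp) {U | PlaqSmall (prm j).δreg U} (K - j) V (bg V)) ∧
          (∀ X, (foot X).Nonempty) ∧ (∀ X b, b ∈ supp X → iterBlockOf (K - j) b.src ∈ foot X) ∧ (∀ X, 0 ≤ len X) ∧ (∀ X, 0 ≤ wt X) ∧
          (∀ X, ∀ y ∈ foot X, ∀ y' ∈ foot X, (Site.tdist y y' : ℝ) ≤ (prm j).M * (len X + 1)) ∧
          (∀ X (U U' : GaugeField (F.P K) 0 (Matrix.specialUnitaryGroup (Fin 2) ℂ)), (∀ b ∈ supp X, U b = U' b) → act X U = act X U') ∧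
          (∀ X, GaugeField.GaugeInvariant (act X)) ∧
          (∀ X V, PlaqSmall (prm j).δ V → PlaqSmall ((prm j).δ * ((F.L : ℝ)⁻¹) ^ (2 * (K - j))) (bg V) →
            |act X (bg V)| ≤ wt X * Real.exp (-((prm j).κ * len X))) ∧
          (∀ y : Site (F.P K) (K - j), ∑ X ∈ Finset.univ.filter (fun X => y ∈ foot X), wt X * Real.exp (-((prm j).κ * len X)) ≤ (prm j).Ccov) ∧
          |cst| ≤ (prm j).cE * Fintype.card (Site (F.P K) (K - j)) ∧
          (∀ V, PlaqSmall (prm j).δ V → PlaqSmall ((prm j).δ * ((F.L : ℝ)⁻¹) ^ (2 * (K - j))) (bg V) →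
            Real.exp (-((prm j).β * wilsonAction4 (bg V)) + (∑ X, act X (bg V)) + cst - (prm j).slack) ≤ readAtLevel F hjK (fun U => Real.exp κ * ρ j U) V) ∧
          (∀ V, PlaqSmall (prm j).δ V → PlaqSmall ((prm j).δ * ((F.L : ℝ)⁻¹) ^ (2 * (K - j))) (bg V) →
            readAtLevel F hjK (fun U => Real.exp κ * ρ j U) V ≤ Real.exp (-((prm j).β * wilsonAction4 (bg V)) + (∑ X, act X (bg V)) + cst + (prm j).slack) + lf V) ∧
          (∀ V, 0 ≤ lf V) ∧ (∀ V, lf V ≤ Real.exp (-(prm j).cLF) * Real.exp ((prm j).c5 * Fintype.card (Site (F.P K) (K - j)))) ∧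
          (∀ V (S : Finset (Plaq (F.P K) (K - j))), (∀ p ∈ S, (prm j).δL ≤ dist1 (GaugeField.plaqHol V p)) →
            readAtLevel F hjK (fun U => Real.exp κ * ρ j U) V ≤ Real.exp (-((prm j).cLF * S.card)) * Real.exp ((prm j).c5 * Fintype.card (Site (F.P K) (K - j))))) ∧ (∃ (K : ℕ) (hjK : j ≤ K),
        ∃ κ : ℝ, ∃ (bg : GaugeField (F.P K) (K - j) (Matrix.specialUnitaryGroup (Fin 2) ℂ) → GaugeField (F.P K) 0 (Matrix.specialUnitaryGroup (Fin 2) ℂ))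
          (nDom : ℕ) (supp : Fin nDom → Set (PBond (F.P K) 0)) (foot : Fin nDom → Finset (Site (F.P K) (K - j)))
          (len : Fin nDom → ℝ) (wt : Fin nDom → ℝ) (act : Fin nDom → GaugeField (F.P K) 0 (Matrix.specialUnitaryGroup (Fin 2) ℂ) → ℝ)
          (cst : ℝ) (lf : GaugeField (F.P K) (K - j) (Matrix.specialUnitaryGroup (Fin 2) ℂ) → ℝ),
          (∀ V, 0 ≤ readAtLevel F hjK (fun U => Real.exp κ * ρ' j U) V) ∧
          Measurable (readAtLevel F hjK (fun U => Real.exp κ * ρ' j U)) ∧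
          GaugeField.GaugeInvariant (readAtLevel F hjK (fun U => Real.exp κ * ρ' j U)) ∧
          (∀ V, PlaqSmall (prm j).δ V →
            IsBackground (fun i => BlockAveraging.blockAvg (P := F.P K) (j := i) ℰp) {U | PlaqSmall (prm j).δreg U} (K - j) V (bg V)) ∧
          (∀ X, (foot X).Nonempty) ∧ (∀ X b, b ∈ supp X → iterBlockOf (K - j) b.src ∈ foot X) ∧ (∀ X, 0 ≤ len X) ∧ (∀ X, 0 ≤ wt X) ∧
          (∀ X, ∀ y ∈ foot X, ∀ y' ∈ foot X, (Site.tdist y y' : ℝ) ≤ (prm j).M * (len X + 1)) ∧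
          (∀ X (U U' : GaugeField (F.P K) 0 (Matrix.specialUnitaryGroup (Fin 2) ℂ)), (∀ b ∈ supp X, U b = U' b) → act X U = act X U') ∧
          (∀ X, GaugeField.GaugeInvariant (act X)) ∧
          (∀ X V, PlaqSmall (prm j).δ V → PlaqSmall ((prm j).δ * ((F.L : ℝ)⁻¹) ^ (2 * (K - j))) (bg V) →
            |act X (bg V)| ≤ wt X * Real.exp (-((prm j).κ * len X))) ∧
          (∀ y : Site (F.P K) (K - j), ∑ X ∈ Finset.univ.filter (fun X => y ∈ foot X), wt X * Real.exp (-((prm j).κ * len X)) ≤ (prm j).Ccov) ∧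
          |cst| ≤ (prm j).cE * Fintype.card (Site (F.P K) (K - j)) ∧
          (∀ V, PlaqSmall (prm j).δ V → PlaqSmall ((prm j).δ * ((F.L : ℝ)⁻¹) ^ (2 * (K - j))) (bg V) →
            Real.exp (-((prm j).β * wilsonAction4 (bg V)) + (∑ X, act X (bg V)) + cst - (prm j).slack) ≤ readAtLevel F hjK (fun U => Real.exp κ * ρ' j U) V) ∧
          (∀ V, PlaqSmall (prm j).δ V → PlaqSmall ((prm j).δ * ((F.L : ℝ)⁻¹) ^ (2 * (K - j))) (bg V) →
            readAtLevel F hjK (fun U => Real.exp κ * ρ' j U) V ≤ Real.exp (-((prm j).β * wilsonAction4 (bg V)) + (∑ X, act X (bg V)) + cst + (prm j).slack) + lf V) ∧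
          (∀ V, 0 ≤ lf V) ∧ (∀ V, lf V ≤ Real.exp (-(prm j).cLF) * Real.exp ((prm j).c5 * Fintype.card (Site (F.P K) (K - j)))) ∧
          (∀ V (S : Finset (Plaq (F.P K) (K - j))), (∀ p ∈ S, (prm j).δL ≤ dist1 (GaugeField.plaqHol V p)) →
            readAtLevel F hjK (fun U => Real.exp κ * ρ' j U) V ≤ Real.exp (-((prm j).cLF * S.card)) * Real.exp ((prm j).c5 * Fintype.card (Site (F.P K) (K - j))))) ∧ μ j {U | ¬ PlaqSmall (θBal F.L γ b₀ p₀ j) U} ≤ ENNReal.ofReal (η j) ∧ μ' j {U | ¬ PlaqSmall (θBal F.L γ b₀ p₀ j) U} ≤ ENNReal.ofReal (η j) ∧ (ContinuousOn (ρ j) {U | PlaqSmall (θBal F.L γ b₀ p₀ j) U} ∧ ContinuousOn (ρ' j) {U | PlaqSmall (θBal F.L γ b₀ p₀ j) U}) ∧ ((∀ (U : GaugeField _ _ ↥(Matrix.specialUnitaryGroup (Fin 2) ℂ)), PlaqSmall (49 / 50 * θBal F.L γ b₀ p₀ j) U → ∀ (b b' : PBond _ _) (v v' : Fin 3 → ℝ),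 ‖v‖ ≤ 1 → ‖v'‖ ≤ 1 → ∃ g : ℂ × ℂ → ℂ, DifferentiableOn ℂ g (Metric.ball (0 : ℂ) (rA * (49 / 50 * θBal F.L γ b₀ p₀ j)) ×ˢ Metric.ball (0 : ℂ) (rA * (49 / 50 * θBal F.L γ b₀ p₀ j))) ∧ (∀ (s t : ℝ) (V Z : GaugeField _ _ ↥(Matrix.specialUnitaryGroup (Fin 2) ℂ)), |s| < rA * (49 / 50 * θBal F.L γ b₀ p₀ j) → |t| < rA * (49 / 50 * θBal F.L γ b₀ p₀ j) → (∀ e, e ≠ b → V e = U e) → V b = U b * expPt (s • v) → (∀ e, e ≠ b' → Z e = V e) → Z b' = V b' * expPt (t • v') → g ((s : ℂ), (t : ℂ)) = (((Real.log (ρ j Z)) : ℝ) : ℂ)) ∧ ∀ z ∈ Metric.ball (0 : ℂ) (rA * (49 / 50 * θBal F.L γ b₀ p₀ j)) ×ˢ Metric.ball (0 : ℂ) (rA * (49 / 50 * θBal F.L γ b₀ p₀ j)), ‖g z - g 0‖ ≤ (Bρ j)) ∧ (∀ (U : GaugeField _ _ ↥(Matrix.specialUnitaryGroup (Fin 2)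 ℂ)), PlaqSmall (49 / 50 * θBal F.L γ b₀ p₀ j) U → ∀ (b b' : PBond _ _) (v v' : Fin 3 → ℝ), ‖v‖ ≤ 1 → ‖v'‖ ≤ 1 → ∃ g : ℂ × ℂ → ℂ, DifferentiableOn ℂ g (Metric.ball (0 : ℂ) (rA * (49 / 50 * θBal F.L γ b₀ p₀ j)) ×ˢ Metric.ball (0 : ℂ) (rA * (49 / 50 * θBal F.L γ b₀ p₀ j))) ∧ (∀ (s t : ℝ) (V Z : GaugeField _ _ ↥(Matrix.specialUnitaryGroup (Fin 2) ℂ)), |s| < rA * (49 / 50 * θBal F.L γ b₀ p₀ j) → |t| < rA * (49 / 50 * θBal F.L γ b₀ p₀ j) → (∀ e, e ≠ b → V e = U e) → V b = U b * expPt (s • v) → (∀ e, e ≠ b' → Z e = V e) → Z b' = V b' * expPt (t • v') → g ((s : ℂ), (t : ℂ)) = (((Real.log (ρ' j Z)) : ℝ) : ℂ)) ∧ ∀ z ∈ Metric.ball (0 : ℂ) (rA * (49 / 50 * θBal F.L γ b₀ p₀ j)) ×ˢ Metric.ball (0 : ℂ) (rA * (49 / 50 * θBal F.L γ b₀ p₀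 j)), ‖g z - g 0‖ ≤ (Bρ j))))) → ∀ (w : ℝ), 0 ≤ w → w / (((F.L : ℝ) ^ Ts / γ) * θBal F.L γ b₀ p₀ Ts ^ 2) ≤ w₀ → (∃ k : PBond (F.P Ts) 0 → PBond (F.P Ts) 0 → ℝ, (∀ b b', 0 ≤ k b b') ∧ (∀ b, ∑ b', k b b' * Real.exp (κ * (b.src.tdist b'.src : ℝ)) ≤ w) ∧ (∀ (b b' : PBond _ _) (v v' : Fin 3 → ℝ) (U V W Z : GaugeField _ _ ↥(Matrix.specialUnitaryGroup (Fin 2) ℂ)), ‖v‖ ≤ (rA / 2) * (θBal F.L γ b₀ p₀ Ts / 4) → ‖v'‖ ≤ (rA / 2) * (θBal F.L γ b₀ p₀ Ts / 4) → PlaqSmall (θBal F.L γ b₀ p₀ Ts / 4) U → PlaqSmall (θBal F.L γ b₀ p₀ Ts / 4) V → PlaqSmall (θBal F.L γ b₀ p₀ Ts / 4) W → PlaqSmall (θBal F.L γ b₀ p₀ Ts / 4) Z → (∀ e, e ≠ b → V e = U e) → V b = U b * expPt v → (∀ e, e ≠ b' → W e = U e) → W b' = U b' * expPt v' → (∀ e,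 e ≠ b' → Z e = V e) → Z b' = V b' * expPt v' → |(Real.log (ρ Ts Z) - Real.log (ρ' Ts Z)) - (Real.log (ρ Ts V) - Real.log (ρ' Ts V)) - (Real.log (ρ Ts W) - Real.log (ρ' Ts W)) + (Real.log (ρ Ts U) - Real.log (ρ' Ts U))| ≤ k b b' * (‖v‖ / (θBal F.L γ b₀ p₀ Ts / 4)) * (‖v'‖ / (θBal F.L γ b₀ p₀ Ts / 4)))) → ∀ (j : ℕ), j₁ ≤ j → j + 1 ≤ Ts → ∃ (c' : Plaq (F.P j) 0 → ℝ) (a' w' : ℝ), 0 ≤ a' ∧ 0 ≤ w' ∧ a' + θ * (w' / (((F.L : ℝ) ^ j / γ) * θBal F.L γ b₀ p₀ j ^ 2)) ≤ (Ctr + εd (T - (Ts + 1)) + C * (w / (((F.L : ℝ) ^ Ts / γ) * θBal F.L γ b₀ p₀ Ts ^ 2))) * (w / (((F.L : ℝ) ^ Ts / γ) * θBal F.L γ b₀ p₀ Ts ^ 2)) + δ j ∧ (∀ p, |c' p| ≤ a') ∧ ∃ k' : PBond (F.P j) 0 → PBond (F.P j) 0 → ℝ, (∀ b b', 0 ≤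 k' b b') ∧ (∀ b, ∑ b', k' b b' * Real.exp (κ * (b.src.tdist b'.src : ℝ)) ≤ w') ∧ (∀ (b b' : PBond _ _) (v v' : Fin 3 → ℝ) (U V W Z : GaugeField _ _ ↥(Matrix.specialUnitaryGroup (Fin 2) ℂ)), ‖v‖ ≤ r * (θBal F.L γ b₀ p₀ j / 4) → ‖v'‖ ≤ r * (θBal F.L γ b₀ p₀ j / 4) → PlaqSmall (θBal F.L γ b₀ p₀ j / 4) U → PlaqSmall (θBal F.L γ b₀ p₀ j / 4) V → PlaqSmall (θBal F.L γ b₀ p₀ j / 4) W → PlaqSmall (θBal F.L γ b₀ p₀ j / 4) Z → (∀ e, e ≠ b → V e = U e) → V b = U b * expPt v → (∀ e, e ≠ b' → W e = U e) → W b' = U b' * expPt v' → (∀ e, e ≠ b' → Z e = V e) → Z b' = V b' * expPt v' → |(Real.log (ρ j Z) - Real.log (ρ' j Z) - ((F.L : ℝ) ^ j / γ) * ∑ p, c' p * (1 - reTr (GaugeField.plaqHol Z p))) - (Real.log (ρ j V) - Real.log (ρ' j V) - ((F.L : ℝ) ^ j / γ) * ∑ p, c' p * (1 - reTr (GaugeField.plaqHol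 V p))) - (Real.log (ρ j W) - Real.log (ρ' j W) - ((F.L : ℝ) ^ j / γ) * ∑ p, c' p * (1 - reTr (GaugeField.plaqHol W p))) + (Real.log (ρ j U) - Real.log (ρ' j U) - ((F.L : ℝ) ^ j / γ) * ∑ p, c' p * (1 - reTr (GaugeField.plaqHol U p)))| ≤ k' b b' * (‖v‖ / (θBal F.L γ b₀ p₀ j / 4)) * (‖v'‖ / (θBal F.L γ b₀ p₀ j / 4))) :=
  Summit.QuantumFields.YangMills.Theorems.OrganTangentTaylorCutHV23.oneStepTransportUH_of_tangentH_jensenH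
    (Summit.QuantumFields.YangMills.Theorems.OrganTangentTangentHOfSpreadFibreLawSqE.tangentH_of_spreadFibreLawHJsq hF)
    (Summit.QuantumFields.YangMills.Theorems.OrganTangentJensenHOfJvarHV23.jensenH_of_jvarH
      (Summit.QuantumFields.YangMills.Theorems.OrganTangentJvarHOfSpreadFibreLawJSqE.jvarH_of_spreadFibreLawHJsq hF))

end Summit.QuantumFields.YangMills.Theorems.OrganTangentOneStepTransportUHOfSpreadFibreLawHJsqE

end
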